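import Literature.NumberTheory.EllipticCurves.BurungaleSkinnerTianWan2024.OrdinaryMainStatementSemistableOfSkinnerUrbanProofs
import Literature.NumberTheory.EllipticCurves.CyclotomicIwasawaMainTheoremIrreducibleBaseChangeProofs
import Literature.NumberTheory.EllipticCurves.QuadraticTwistMinimalModelProofs
import Literature.NumberTheory.EllipticCurves.RootNumberProofs
import Literature.NumberTheory.EllipticCurves.ModularCurveManinSemistableCoprimeFormProofs
import Literature.NumberTheory.EllipticCurves.SzpiroLocalDataProofs
import Literature.NumberTheory.EllipticCurves.SzpiroMinimalityProofs
import Literature.NumberTheory.EllipticCurves.ModularityVersionApProofs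
import Literature.NumberTheory.DiophantineGeometry.MinimalDiscriminantSmulProofs
import Literature.NumberTheory.DiophantineGeometry.LocalReductionProofs
import HarnessLib

/-!
# BSTW arXiv:2409.01350v2 Thm. 10.10, QUADRATIC-TWIST clause of part (a) — its typed OPEN binder is
# a CONSEQUENCE of refereed print already in the tree (Skinner–Urban 2014 Thm. 3.6.9 applied to the
# twist, with (ram) transported from the semistable curve's Ribet prime): proofs only

Companion of `OrdinaryMainStatementSemistableOfSkinnerUrbanProofs.lean` (the SEMISTABLE clause),
written by the ARM-P referee-reader `bsd-cited-r03` (cell `run/shared/lean/pub/bsd-cited/`,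
register R-01).  A *proofs* file: theorems only, no definition, no named fact, no `sorry`.

## What is proved

`OrdinaryMainStatementSemistableOPEN.lean` (typer `bsd-littype-01`) types the last sentence of
Burungale–Skinner–Tian–Wan, arXiv:2409.01350v2, Thm. 10.10 — "the same holds for `g_K := g ⊗ χ_K`
for any quadratic field extension `K/ℚ` with `(D_K, Np) = 1`" — for part (a), as the OPEN binder
`thm1010_twist_mainStatement_OPEN`: for `W₀/ℚ` globally minimal and SEMISTABLE, `p ≠ 2` good ordinary
with `E₀[p]` irreducible, `K = ℚ(√d)` (`d` square-free `≠ 1`, every prime ramified in `K` is `≠ p`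
and `∤ N_{E₀}`), and `W` a globally minimal model of `E₀^{(d)}`, the integral cyclotomic main
conjecture `CharIdealEqPadicLFunctionNeron W p`.

This file derives that binder from named REFEREED facts already in the tree:

* `skinner_urban_main_conjecture` ([SU14] Thm. 3.6.9; clauses (1), (3)) APPLIED TO THE TWIST `W`:
  `W` is good ordinary at `p` (`p ∤ 2d`: `isOrdinaryAt_of_smul_eq_quadraticTwist`), `E^{(d)}[p]` is
  irreducible (`hasIrreducibleModPGaloisRep_of_smul_eq_quadraticTwist`), and (ram) holds for `W` at
  `p`: the semistable `E₀` has a multiplicative prime `ℓ ≠ p` with `p ∤ ord_ℓ Δ_min(E₀)` by Ribet's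
  level-lowering (`SkinnerUrban2014.ram_of_semistable_of_irr`, over `exists_isNewformOf` and
  `diamond1995_refinedSerre`); `ℓ ∣ N_{E₀}`, so `ℓ` is UNRAMIFIED in `ℚ(√d)` by the binder's
  "`(D_K, Np) = 1`", i.e. `d` is an `ℓ`-adic unit and `d ≡ 1 (mod 4)` if `ℓ = 2`; then `E₀^{(d)}` has
  the integral twist model `W₀.twistModel ((d-1)/4)`, minimal at `ℓ` with `c₄ ↦ d² c₄`,
  `Δ ↦ d⁶ Δ`, so `W` is again multiplicative at `ℓ` with the same `ord_ℓ Δ_min`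
  (`ram_of_smul_eq_quadraticTwist_of_not_ramifiedInQuadratic`, from the tree's
  `isMinimalAt_twistModel` / `ordMinimalDiscriminant_twistModel` /
  `hasMultiplicativeReductionAt_iff_of_isMinimalAt` / `…_smul_iff`);
* "`ρ̄_{E^{(d)},p^n}` onto for all `n`" from (irr) + (ram) (`Rank1Residual.surj_of_irr_of_ram`, Serre
  1972 Prop. 15, and the (ram) transvection `hasSurjectiveModNGaloisRep_pow_of_hasMultiplicativeReductionAtPrime`);
* the Néron normalisation by the Greenberg–Vatsal period unit (`h5`, `h3`;
  `Rank1Residual.periodUnit_of_realPeriodRat_eq_unit_mul_plusPeriod`).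

So, exactly as for the semistable clause, the preprint's twist clause adds a ROAD (zeta elements),
not a statement, to what refereed print already yields; together with
`thm1010a_mainStatement_semistable_ordinary_OPEN_of_skinnerUrban` both OPEN binders of the typer's
file are consequences of `hSU`, `h5`, `h3`, `hmod`, `hLL`.  Nothing here asserts the main
conjecture: every theorem is CONDITIONAL on those named facts.

## References
* [BurungaleSkinnerTianWan2024] arXiv:2409.01350v2, Thm. 10.10 last sentence and Rem. 10.11 (p. 89;
  TeX l.7525–7533).
* [SkinnerUrban2014] Invent. Math. 195 (2014), Thm. 3.6.9 (p. 45 of the author version).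
* [SilvermanAEC2009] VII.1 Prop. 1.3, VII.5 Prop. 5.1 (minimal equations, reduction types), X.5 Cor. 5.4.
* [Ribet1990] Thm. 1.1; [GreenbergVatsal2000] §3 Rem. 3.4.
-/

set_option autoImplicit false

noncomputable section

open scoped Classical MatrixGroups ModularForm

open CongruenceSubgroup WeierstrassCurve Literature.NumberTheory.EllipticCurves
  Literature.NumberTheory.EllipticCurves.ModularForms
  Literature.NumberTheory.EllipticCurves.Rank1Residual
  Literature.NumberTheory.EllipticCurves.SkinnerUrban2014
  Literature.NumberTheory.Automorphic
  IsDedekindDomain Rat.HeightOneSpectrum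

namespace Literature.NumberTheory.EllipticCurves.BurungaleSkinnerTianWan2024

/-! ## §1. The integral main conjecture (Néron normalisation) under (irr) + (ram), pointwise -/

/-- **Skinner–Urban 2014 Thm. 3.6.9 ⟹ `CharIdealEqPadicLFunctionNeron W p` on {`p ≥ 3` good
ordinary, `E[p]` irreducible, (ram)}** — the Literature-side twin of the Summits theorem
`mazurMainConjecture_of_skinnerUrban_of_ram`: (irr) + (ram) ⟹ `ρ̄_{E,p}` onto (`surj_of_irr_of_ram`)
⟹ `ρ̄_{E,p^n}` onto for all `n` (the (ram) transvection), so clause (3) of `hSU` gives `ι g = L_p(f, α)`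
with `char = (g)`; the passage to `ϖ · L_p(f, α)` (`ϖ · Ω_E = Ω⁺_f`) is the period unit `ord_p ϖ = 0`
(`h5`, `h3`).  CONDITIONAL on the three named facts; closes nothing by itself.
[cite: SkinnerUrban2014, Thm. 3.6.9 (p. 45)] [cite: GreenbergVatsal2000, §3, Remark 3.4]
[cite: Serre1972, §2.4 Prop. 15; IV §3.4 Lemma 2] -/
theorem charIdealEqPadicLFunctionNeron_of_skinnerUrban_of_ram
    (hSU : ∀ (W : WeierstrassCurve ℚ) [W.IsElliptic] [W.IsGloballyMinimal] (p : ℕ) [Fact p.Prime]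
      (κ : ZpExtension ℚ p) (γ : Field.absoluteGaloisGroup ℚ) (N : ℕ) [NeZero N]
      (f : CuspForm (Gamma0 N) 2),
      skinner_urban_main_conjecture W p (κ := κ) (γ := γ) (f := f))
    (h5 : realPeriodRat_eq_unit_mul_plusPeriod) (h3 : realPeriodRat_eq_unit_mul_plusPeriod_three)
    (W : WeierstrassCurve ℚ) [W.IsElliptic] [W.IsGloballyMinimal] (p : ℕ) [Fact p.Prime]
    (hp3 : 3 ≤ p) (hgood : W.HasGoodReductionAtPrime p) (hord : ¬ (p : ℤ) ∣ W.frobeniusTrace p)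
    (hirr : W.HasIrreducibleModPGaloisRep p) (hram : Ram W p) :
    CharIdealEqPadicLFunctionNeron W p := by
  intro κ γ hκ hγ hγ' _ f hf ϖ hϖ D
  have hp2 : p ≠ 2 := by omega
  have hsur : ∀ n : ℕ, W.HasSurjectiveModNGaloisRep (p ^ n : ℕ) :=
    hasSurjectiveModNGaloisRep_pow_of_hasMultiplicativeReductionAtPrime W p
      (surj_of_irr_of_ram W p hirr hram) hram
  obtain ⟨hX, -, hint⟩ := hSU W p κ γ _ f hp3 hgood hord hirr hram hκ hγ hγ' hf D
  obtain ⟨g, hιg, hchar⟩ := hint hsur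
  have hv : padicValRat p ϖ = 0 :=
    periodUnit_of_realPeriodRat_eq_unit_mul_plusPeriod h5 h3 W p hp2 hgood hirr f hf ϖ hϖ
  have hϖ0 : ϖ ≠ 0 := by
    have hpos : 0 < plusPeriod f := IsNewform0.plusPeriod_pos_holds hf.1 hf.coeffField_eq_bot
    rintro rfl
    simp only [Rat.cast_zero, zero_mul] at hϖ
    exact absurd hϖ hpos.ne
  have hnorm : ‖((ϖ : ℚ) : ℚ_[p])‖ = 1 := by
    rw [Padic.eq_padicNorm, padicNorm.eq_zpow_of_nonzero hϖ0, hv]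
    simp
  set u : ℤ_[p] := ⟨((ϖ : ℚ) : ℚ_[p]), hnorm.le⟩ with hu
  have hunit : IsUnit u := PadicInt.isUnit_iff.mpr hnorm
  refine ⟨hX, PowerSeries.C u * g, ?_, ?_⟩
  · rw [hchar]
    exact (Ideal.span_singleton_mul_left_unit (hunit.map PowerSeries.C) g).symm
  · rw [map_mul, hιg, PowerSeries.map_C]
    rfl

/-! ## §2. (ram) passes to a quadratic twist unramified at the (ram) prime -/

/-- `ord_u Δ_min` over `ℤ` is the `ℓ`-adic valuation of the global minimal discriminant
(`ℓ` the prime below `u`). [cite: SilvermanAEC2009, VIII.8] -/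
private theorem ordMinimalDiscriminant_eq_padicValInt_natGenerator (W : WeierstrassCurve ℚ)
    [W.IsElliptic] [W.IsGloballyMinimal] (u : HeightOneSpectrum ℤ) :
    W.ordMinimalDiscriminant u = padicValInt (natGenerator u) W.minimalDiscriminantInt := by
  rw [← W.factorization_minimalDiscriminantNorm_holds u,
    minimalDiscriminantNorm_int_eq_natAbs_minimalDiscriminantInt_holds W,
    Nat.factorization_def _ (show (natGenerator u).Prime from (primesEquiv u).2)]
  rfl

/-- **(ram) is inherited by a quadratic twist unramified at the (ram) prime.** Let `W₀, W/ℚ` be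
globally minimal and elliptic, `C • W = W₀^{(d)}` (`d` an integer), and `ℓ ≠ p` a prime of
multiplicative reduction of `W₀` with `p ∤ ord_ℓ Δ_min(W₀)` at which `ℚ(√d)` is UNRAMIFIED
(`¬ RamifiedInQuadratic d ℓ`: `ℓ ∤ d`, and `d ≡ 1 (mod 4)` if `ℓ = 2`).  Then `W` has multiplicative
reduction at `ℓ` with `ord_ℓ Δ_min(W) = ord_ℓ Δ_min(W₀)`, so `Ram W p`.  Proof: with `k = (d-1)/4`,
`|k|_ℓ ≤ 1` and `|4k+1|_ℓ = |d|_ℓ = 1`, the integral twist model `W₀.twistModel k` is a model of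
`E₀^{(d)}` over `ℚ` (`exists_variableChange_twistModel_eq_quadraticTwist`), minimal at `ℓ`
(`isMinimalAt_twistModel`) with `c₄ ↦ d² c₄`, `Δ ↦ d⁶ Δ` and the same `ord_ℓ Δ_min`
(`ordMinimalDiscriminant_twistModel`); reduction type and `ord_ℓ Δ_min` are `ℚ`-isomorphism
invariants (`hasMultiplicativeReductionAt_smul_iff`, `ordMinimalDiscriminant_smul`).  Silverman
*AEC* VII.1 Prop. 1.3, VII.5 Prop. 5.1 (b). [cite: SilvermanAEC2009, VII.1 Prop. 1.3(b) and VII.5 Prop. 5.1(b)] -/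
theorem ram_of_smul_eq_quadraticTwist_of_not_ramifiedInQuadratic
    (W₀ W : WeierstrassCurve ℚ) [W₀.IsElliptic] [W₀.IsGloballyMinimal] [W.IsElliptic]
    [W.IsGloballyMinimal] (p : ℕ) [Fact p.Prime] {d : ℤ} {C : VariableChange ℚ}
    (hC : C • W = W₀.quadraticTwist (d : ℚ)) {ℓ : ℕ} (hℓ : ℓ.Prime) (hℓp : ℓ ≠ p)
    (hmult : haveI := Fact.mk hℓ; W₀.HasMultiplicativeReductionAtPrime ℓ)
    (hval : ¬ p ∣ padicValInt ℓ W₀.minimalDiscriminantInt) (hunr : ¬ RamifiedInQuadratic d ℓ) :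
    Ram W p := by
  haveI : Fact ℓ.Prime := ⟨hℓ⟩
  -- the place `u` of `ℤ` below `ℓ`
  set u : HeightOneSpectrum ℤ := (primesEquiv (R := ℤ)).symm ⟨ℓ, hℓ⟩ with hu
  have hpu : primesEquiv u = ⟨ℓ, hℓ⟩ := (primesEquiv (R := ℤ)).apply_symm_apply ⟨ℓ, hℓ⟩
  have hℓu : natGenerator u = ℓ := congrArg Subtype.val hpu
  -- `ℓ` unramified in `ℚ(√d)`: `ℓ ∤ d`, and `4 ∣ d - 1` if `ℓ = 2`
  have hℓd : ¬ (ℓ : ℤ) ∣ d := fun h ↦ hunr (Or.inl h)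
  have h2 : ℓ = 2 → d % 4 = 1 := fun h ↦ by
    by_contra h4
    exact hunr (Or.inr ⟨h, h4⟩)
  -- the twisting parameter `k = (d - 1)/4`, `4k + 1 = d`
  set k : ℚ := ((d : ℚ) - 1) / 4 with hk
  have hk4 : 4 * k + 1 = (d : ℚ) := by rw [hk]; ring
  -- `|4k + 1|_u = |d|_u = 1`
  have hvd : u.valuation ℚ (4 * k + 1) = 1 := by
    rw [hk4, show ((d : ℚ)) = algebraMap ℤ ℚ d from rfl, HeightOneSpectrum.valuation_of_algebraMap]
    exact intValuation_eq_one_of_not_dvd u (by rwa [hℓu])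
  -- `|k|_u ≤ 1`
  have hvk : u.valuation ℚ k ≤ 1 := by
    rcases eq_or_ne ℓ 2 with h | h
    · -- `ℓ = 2`: `d ≡ 1 (mod 4)`, so `k` is an integer
      have h4 : (4 : ℤ) ∣ d - 1 := by
        have := h2 h
        omega
      obtain ⟨m, hm⟩ := h4
      have hkm : k = (m : ℚ) := by
        rw [hk]
        have : ((d : ℚ) - 1) = 4 * (m : ℚ) := by exact_mod_cast hm
        rw [this]; ring
      rw [hkm, show ((m : ℚ)) = algebraMap ℤ ℚ m from rfl, HeightOneSpectrum.valuation_of_algebraMap]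
      exact HeightOneSpectrum.intValuation_le_one u m
    · -- `ℓ` odd: `4` is a `u`-unit and `d - 1` is `u`-integral
      have h4u : u.valuation ℚ (4 : ℚ) = 1 := by
        rw [show (4 : ℚ) = algebraMap ℤ ℚ 4 from by norm_num, HeightOneSpectrum.valuation_of_algebraMap]
        refine intValuation_eq_one_of_not_dvd u ?_
        rw [hℓu]
        intro h4
        have h22 : (ℓ : ℤ) ∣ 2 * 2 := by simpa using h4
        rcases (Int.Prime.dvd_mul' hℓ h22) with h' | h' <;>
        · have : ℓ ∣ 2 := by exact_mod_cast h'
          exact h ((Nat.prime_dvd_prime_iff_eq hℓ Nat.prime_two).mp this)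
      have hd1 : u.valuation ℚ ((d : ℚ) - 1) ≤ 1 := by
        rw [show ((d : ℚ) - 1) = algebraMap ℤ ℚ (d - 1) from by push_cast; rfl,
          HeightOneSpectrum.valuation_of_algebraMap]
        exact HeightOneSpectrum.intValuation_le_one u _
      rw [hk, map_div₀, h4u, div_one]
      exact hd1
  -- the integral twist model is a `ℚ`-model of `E₀^{(d)}`, hence `ℚ`-isomorphic to `W`
  obtain ⟨C', -, hC'⟩ := W₀.exists_variableChange_twistModel_eq_quadraticTwist k
  rw [hk4, ← hC] at hC'
  -- `W = (C⁻¹ * C') • W₀.twistModel k`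
  have hW : W = (C⁻¹ * C') • W₀.twistModel k := by rw [mul_smul, hC', inv_smul_smul]
  haveI hEt : (W₀.twistModel k).IsElliptic := by
    have : W₀.twistModel k = (C⁻¹ * C')⁻¹ • W := by rw [hW, inv_smul_smul]
    rw [this]; infer_instance
  -- minimality at `u` of `W₀` and of the twist model
  have hmin₀ : W₀.IsMinimalAt u := IsGloballyMinimal.isMinimalAt_int W₀ u
  have hminT : (W₀.twistModel k).IsMinimalAt u := isMinimalAt_twistModel u W₀ hmin₀ hvk hvd
  -- multiplicative reduction at `u`: `W₀` ⟹ twist model ⟹ `W`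
  have hm₀ : W₀.HasMultiplicativeReductionAt u := by
    have h := hasMultiplicativeReductionAtPrime_primesEquiv_iff_hasMultiplicativeReductionAt W₀ u
    rw [hpu] at h
    exact h.mp hmult
  have hmT : (W₀.twistModel k).HasMultiplicativeReductionAt u := by
    rw [hasMultiplicativeReductionAt_iff_of_isMinimalAt hminT, twistModel_Δ, twistModel_c₄, map_mul,
      map_mul, map_pow, map_pow, hvd, one_pow, one_pow, one_mul, one_mul]
    exact (hasMultiplicativeReductionAt_iff_of_isMinimalAt hmin₀).mp hm₀
  have hmW : W.HasMultiplicativeReductionAt u := by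
    rw [hW]
    exact (hasMultiplicativeReductionAt_smul_iff_holds u (W₀.twistModel k) (C⁻¹ * C')).mpr hmT
  have hmultW : W.HasMultiplicativeReductionAtPrime ℓ := by
    have h := hasMultiplicativeReductionAtPrime_primesEquiv_iff_hasMultiplicativeReductionAt W u
    rw [hpu] at h
    exact h.mpr hmW
  -- `ord_ℓ Δ_min`: `W` = twist model = `W₀`
  have hordW : W.ordMinimalDiscriminant u = W₀.ordMinimalDiscriminant u := by
    rw [hW, ordMinimalDiscriminant_smul_holds u (W₀.twistModel k) (C⁻¹ * C'),
      ordMinimalDiscriminant_twistModel u W₀ hvk hvd]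
  have hvalW : padicValInt ℓ W.minimalDiscriminantInt = padicValInt ℓ W₀.minimalDiscriminantInt := by
    have h1 := ordMinimalDiscriminant_eq_padicValInt_natGenerator W u
    have h0 := ordMinimalDiscriminant_eq_padicValInt_natGenerator W₀ u
    rw [hℓu] at h1 h0
    rw [← h1, ← h0, hordW]
  exact ⟨ℓ, ⟨hℓ⟩, hℓp, hmultW, by rwa [hvalW]⟩

/-! ## §3. The twist clause of BSTW Thm. 10.10 (a) from Skinner–Urban -/

/-- **BSTW Thm. 10.10, QUADRATIC-TWIST clause of part (a) — the typed OPEN preprint binder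
`thm1010_twist_mainStatement_OPEN` is a CONSEQUENCE of refereed print already in the tree**: granted
Skinner–Urban 2014 Thm. 3.6.9 (`hSU`, bsd.S21), the Greenberg–Vatsal period-unit facts (`h5`, `h3`),
modularity (`hmod`) and Ribet–Diamond level-lowering (`hLL`), the binder holds.  For `W₀` semistable,
`p ≠ 2` good ordinary, `E₀[p]` irreducible, `d` square-free with every prime ramified in `ℚ(√d)`
prime to `Np`, and `W` a globally minimal model of `E₀^{(d)}`: `p ∤ d` (else `p` ramifies), so `W` is
good ordinary at `p` (`isOrdinaryAt_of_smul_eq_quadraticTwist`) with `E^{(d)}[p]` irreducible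
(`hasIrreducibleModPGaloisRep_of_smul_eq_quadraticTwist`); `E₀`'s Ribet prime `ℓ`
(`ram_of_semistable_of_irr`) divides `N_{E₀}`, hence is unramified in `ℚ(√d)`, hence is a (ram)
prime of `W` (§2); conclude by §1.  So BOTH clauses of the preprint's Thm. 10.10 (a) add a ROAD at
`p = 3` (zeta elements; Rem. 10.11), not a statement.  CONDITIONAL; closes nothing by itself.
[cite: BurungaleSkinnerTianWan2024, Thm. 10.10, last sentence, and Rem. 10.11 (p. 89; label IMC_ord)]
[cite: SkinnerUrban2014, Thm. 3.6.9 and the remark before Cor. 3.6.10 (p. 45)] -/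
theorem thm1010_twist_mainStatement_OPEN_of_skinnerUrban
    (hSU : ∀ (W : WeierstrassCurve ℚ) [W.IsElliptic] [W.IsGloballyMinimal] (p : ℕ) [Fact p.Prime]
      (κ : ZpExtension ℚ p) (γ : Field.absoluteGaloisGroup ℚ) (N : ℕ) [NeZero N]
      (f : CuspForm (Gamma0 N) 2),
      skinner_urban_main_conjecture W p (κ := κ) (γ := γ) (f := f))
    (h5 : realPeriodRat_eq_unit_mul_plusPeriod) (h3 : realPeriodRat_eq_unit_mul_plusPeriod_three)
    (hmod : exists_isNewformOf) (hLL : diamond1995_refinedSerre) :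
    thm1010_twist_mainStatement_OPEN := by
  intro W₀ W _ _ _ _ p _ d C hp2 hsst hgood hord hirr hsq hd1 hram hC
  have hp : p.Prime := Fact.out
  have hp3 : 3 ≤ p := by have := hp.two_le; omega
  have hd0 : d ≠ 0 := hsq.ne_zero
  have hd0Q : (d : ℚ) ≠ 0 := by exact_mod_cast hd0
  -- `p ∤ d`: `p` would ramify in `ℚ(√d)`
  have hpd : ¬ (p : ℤ) ∣ d := fun h ↦ (hram p (Or.inl h)).1 rfl
  -- `W` is good ordinary at `p` with `E^{(d)}[p]` irreducible
  obtain ⟨hgood', hord'⟩ : IsOrdinaryAt W p :=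
    isOrdinaryAt_of_smul_eq_quadraticTwist W₀ W hsq hC p hp2 hpd ⟨hgood, hord⟩
  have hirr' : W.HasIrreducibleModPGaloisRep p :=
    hasIrreducibleModPGaloisRep_of_smul_eq_quadraticTwist W₀ W p hd0Q hC hirr
  -- `E₀`'s Ribet prime `ℓ`, unramified in `ℚ(√d)` since `ℓ ∣ N_{E₀}`
  obtain ⟨ℓ, hℓ, hℓp, hmult, hval⟩ := ram_of_semistable_of_irr hmod hLL W₀ p hp2 hgood hsst hirr
  have hℓN : ℓ ∣ W₀.conductorNorm ℤ :=
    (dvd_conductorNorm_iff_not_hasGoodReductionAtPrime W₀ ℓ).mpr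
      (WeierstrassCurve.HasMultiplicativeReduction.not_hasGoodReduction (R := ℤ_[ℓ]) hmult)
  have hunr : ¬ RamifiedInQuadratic d ℓ := fun h ↦ (hram ℓ h).2 hℓN
  -- (ram) for the twist, then Skinner–Urban
  exact charIdealEqPadicLFunctionNeron_of_skinnerUrban_of_ram hSU h5 h3 W p hp3 hgood' hord' hirr'
    (ram_of_smul_eq_quadraticTwist_of_not_ramifiedInQuadratic W₀ W p hC hℓ.out hℓp hmult hval hunr)

end Literature.NumberTheory.EllipticCurves.BurungaleSkinnerTianWan2024

end
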